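import Mathlib
import Literature.Analysis.UnboundedOperators.HeatFlowCalculus
import HarnessLib

/-!
# The `L²` norm of the Gauss–Weierstrass kernel: `∫ G_σ² = G_{2σ}(0) = (8πσ)^{-n/2}`

For the heat kernel `G_σ(x) = (4πσ)^{-n/2} e^{-‖x‖²/(4σ)}` on a finite-dimensional real inner product
space `E` (`Literature.Analysis.UnboundedOperators.heatKernel`, `n = finrank ℝ E`) this file records the
sharp `L²` law of the free heat flow issued from a point mass / from Gaussian data:

* `integral_heatKernel_sq` — `∫ G_σ(x)² dx = G_{2σ}(0)`, read off the semigroup law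
  `G_σ ⋆ G_σ = G_{2σ}` (`heatKernel_convolution_heatKernel_holds`) evaluated at `x = 0`;
* `integral_heatKernel_sq_eq` — the closed form `∫ G_σ² = (8πσ)^{-n/2}`; in particular
  `integral_heatKernel_sq_eq_three : ∫_{ℝ³} G_σ² = (8πσ)^{-3/2}`;
* `integrable_heatKernel_sq`, `lintegral_heatKernel_sq` (the same law for the lower Lebesgue integral
  of `‖G_σ‖ₑ²`, the shape in which energy classes are typed in the NS files), and the strict monotone
  decay `integral_heatKernel_sq_lt` (`σ < τ ⇒ ∫ G_τ² < ∫ G_σ²`).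

So the `L²` energy of the heat flow of a Gaussian datum decays EXACTLY like `σ^{-n/2}` — the rate
`t^{-(n/2)(1/p - 1/q)}` of the `L^p → L^q` estimates (Giga–Giga–Saal §1.1.3) at `p = 1`, `q = 2` is
attained; no faster algebraic rate `(1+t)^{-α}`, `α > n/2`, holds for data of non-zero mass. This is the
reusable test object behind the NS-claims record C88 (D-0090; `…Theorems.Rockwell2025.not_Step_62`:
a display asserting `L²`-decay `(1+t)^{-(K−3)}` for a weighted heat flow).

Sources: L. C. Evans, *Partial Differential Equations* (2010), §2.3.1 (fundamental solution, semigroup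
identity); M.-H. Giga, Y. Giga, J. Saal, *Nonlinear PDE* (2010), §1.1.3 (`L^p`–`L^q` decay of `e^{tΔ}`,
sharpness on Gaussians). [cite: Evans2010, §2.3.1]

WHAT THIS IS NOT: not a claim about NS regularity or blow-up; not a claim about any author beyond the
typed locator (filed by the NS-claims sweep, D-0090, salvage seat ns-claims-salvage-p4).
-/

noncomputable section

open MeasureTheory Real
open scoped ENNReal Convolution

namespace Literature.Analysis.UnboundedOperators

variable {E : Type*} [NormedAddCommGroup E] [InnerProductSpace ℝ E]

variable [FiniteDimensional ℝ E] [MeasurableSpace E] [BorelSpace E]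

/-- **`∫ G_σ² = G_{2σ}(0)`**: the semigroup law `G_σ ⋆ G_σ = G_{2σ}` at the origin, using evenness of
the kernel (`heatKernel_neg`, HeatFlowCalculus.lean). [cite: Evans2010, §2.3.1] -/
theorem integral_heatKernel_sq {σ : ℝ} (hσ : 0 < σ) :
    ∫ x : E, heatKernel σ x ^ 2 = heatKernel (E := E) (2 * σ) 0 := by
  have h := heatKernel_convolution_heatKernel_holds (E := E) hσ hσ
  have h0 := congrFun h 0
  rw [convolution_lsmul] at h0
  rw [show 2 * σ = σ + σ by ring, ← h0]
  refine integral_congr_ae (Filter.Eventually.of_forall fun x => ?_)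
  simp only [zero_sub, heatKernel_neg, smul_eq_mul, sq]

/-- **Closed form `∫ G_σ² = (8πσ)^{-n/2}`**, `n = finrank ℝ E`. [cite: Evans2010, §2.3.1] -/
theorem integral_heatKernel_sq_eq {σ : ℝ} (hσ : 0 < σ) :
    ∫ x : E, heatKernel σ x ^ 2 = (8 * π * σ) ^ (-(Module.finrank ℝ E : ℝ) / 2) := by
  rw [integral_heatKernel_sq hσ, heatKernel_eq]
  simp only [norm_zero, ne_eq, OfNat.ofNat_ne_zero, not_false_eq_true, zero_pow, mul_zero,
    Real.exp_zero, mul_one]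
  ring_nf

/-- The `ℝ³` instance: `∫_{ℝ³} G_σ² = (8πσ)^{-3/2}` — the `t^{-3/2}` law of the heat-flow energy in
three dimensions. [cite: Evans2010, §2.3.1] -/
theorem integral_heatKernel_sq_eq_three {σ : ℝ} (hσ : 0 < σ) :
    ∫ x : EuclideanSpace ℝ (Fin 3), heatKernel σ x ^ 2 = (8 * π * σ) ^ (-(3 : ℝ) / 2) := by
  rw [integral_heatKernel_sq_eq hσ, finrank_euclideanSpace_fin]
  norm_num

/-- `G_σ²` is integrable (bounded by `(4πσ)^{-n/2} G_σ`). [cite: Evans2010, §2.3.1] -/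
theorem integrable_heatKernel_sq {σ : ℝ} (hσ : 0 < σ) :
    Integrable (fun x : E => heatKernel σ x ^ 2) := by
  have hG := integrable_heatKernel_holds (E := E) hσ
  refine (hG.const_mul ((4 * π * σ) ^ (-(Module.finrank ℝ E : ℝ) / 2))).mono'
    ((continuous_heatKernel σ).pow 2).aestronglyMeasurable (Filter.Eventually.of_forall fun x => ?_)
  rw [Real.norm_eq_abs, abs_of_nonneg (sq_nonneg _), sq]
  exact mul_le_mul_of_nonneg_right (heatKernel_le hσ x) (heatKernel_pos hσ x).le

/-- The same law for the lower Lebesgue integral of `‖G_σ‖ₑ²` (the shape of typed energy classes):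
`∫⁻ ‖G_σ x‖ₑ² = ofReal ((8πσ)^{-n/2})`. [cite: Evans2010, §2.3.1] -/
theorem lintegral_heatKernel_sq {σ : ℝ} (hσ : 0 < σ) :
    (∫⁻ x : E, ‖heatKernel σ x‖ₑ ^ 2) =
      ENNReal.ofReal ((8 * π * σ) ^ (-(Module.finrank ℝ E : ℝ) / 2)) := by
  rw [← integral_heatKernel_sq_eq hσ, ofReal_integral_eq_lintegral_ofReal (integrable_heatKernel_sq hσ)
    (Filter.Eventually.of_forall fun x => sq_nonneg _)]
  refine lintegral_congr fun x => ?_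
  rw [← ofReal_norm, Real.norm_eq_abs, abs_of_pos (heatKernel_pos hσ x),
    ENNReal.ofReal_pow (heatKernel_pos hσ x).le]

/-- Strict algebraic decay: `σ < τ ⇒ ∫ G_τ² < ∫ G_σ²` (when `n ≥ 1`). [cite: Evans2010, §2.3.1] -/
theorem integral_heatKernel_sq_lt [Nontrivial E] {σ τ : ℝ} (hσ : 0 < σ) (hστ : σ < τ) :
    ∫ x : E, heatKernel τ x ^ 2 < ∫ x : E, heatKernel σ x ^ 2 := by
  have hτ : 0 < τ := hσ.trans hστ
  rw [integral_heatKernel_sq_eq hσ, integral_heatKernel_sq_eq hτ]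
  have hn : 0 < (Module.finrank ℝ E : ℝ) := by exact_mod_cast Module.finrank_pos
  have hexp : -(Module.finrank ℝ E : ℝ) / 2 < 0 := by linarith
  exact Real.rpow_lt_rpow_of_neg (by positivity) (by nlinarith [Real.pi_pos]) hexp

end Literature.Analysis.UnboundedOperators

end
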